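import Summits.HodgeConjecture.CorCM.CyclicSexticInducedType
import Literature.AlgebraicGeometry.Motives.VarietiesDimensionProofs
import Literature.AlgebraicGeometry.ComplexMultiplication.ShimuraIsogenousPowerOfRiemann
import HarnessLib

/-!
# CM types of a Galois SEXTIC CM field, IV: the induced corner is isogenous to a power of a CM elliptic curve

HONEST FRAMING (cell `pub-hodgecm2` / COR-CM, seat b24 gen 8; COUNT-NEUTRAL — no binder row of
`HOME/BINDER-OWNERS.md` is touched).  Step L3 (first half) of `HOME/pub-hodgecm2-lit-andre-3/A1-BLUEPRINT.md`
on the tree's real carriers, MODULO the cell's two displayed records `hR` (`DeligneMilne1982_Thm_6_20_full`, B02)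
and `h₃` (`PicardCM.CMAbelianVarietyRealised`, a universe parameter): for a Galois sextic CM field `K` with
`σ³ = ρ` and `k = K^{⟨σ²⟩}` its imaginary quadratic subfield,

* `exists_cmCurve_isogeny_of_sq_stable` — a realisation `(A, ι, θ)` of a `σ²`-STABLE CM type `Φ` of `K` is
  isogenous, `𝓞_k`-equivariantly, to a power `E^h` of a CM ELLIPTIC CURVE `(E, ι_E, θ_E)` realising a CM type
  `Φ₀` of `k` (`dim E = 1`): `CyclicSextic.exists_inducedCMType_of_sq_stable` (part III) feeds the tree's
  KERNEL theorem `ComplexMultiplication.thm3_isogenousPower_of_riemann (hR) (h₃)` (Shimura 1998 §6.2 Thm. 3 /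
  §8.2, type inflation);
* `face_induced_corner_isogenous_cmCurve_power` — for every rank-four face `f` of `K` and realisations
  `(A_j, ι_j, θ_j)` of its four corners, some corner `j₀` is such an `E^h` up to `𝓞_k`-isogeny (the maps
  `ν_j = g ≫ π_j : A_{j₀} → E` of the blueprint), while the other three corners are primitive
  (`face_corner_pattern`, part II).

THEOREMS ONLY; no `sorry`; axioms `propext`, `Classical.choice`, `Quot.sound`; conclusions CONDITIONAL on the
displayed `hR`, `h₃` exactly as every `…OfRiemann` file of the cell.

## References
* [Shimura1998] G. Shimura, *Abelian Varieties with Complex Multiplication and Modular Functions* (1998), §6.2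
  Thm. 3, §8.2 (as typed in `ComplexMultiplication/ShimuraInflation.lean`, `ShimuraIsogenousPowerOfRiemann.lean`).
* [DeligneMilne1982Tannakian] P. Deligne, J. S. Milne, LNM 900 (1982), §6 Thm. 6.20 (Riemann) — the record `hR`.
-/

noncomputable section

namespace Summit.HodgeConjecture.CorCM.CyclicSextic

open CategoryTheory CategoryTheory.Limits NumberField
open Literature.AlgebraicGeometry.Motives (CMType AbelianVariety)
open Literature.AlgebraicGeometry.HodgeTheory (complexBetti DeligneMilne1982_Thm_6_20_full)
open Literature.AlgebraicGeometry.ComplexMultiplication (IsCMTypeRealisation thm3_isogenousPower_of_riemann)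
open Literature.NumberTheory.ComplexMultiplication (conjGal inducedCMType)
open Literature.NumberTheory.Automorphic.PicardCM (CMAbelianVarietyRealised)
open Literature.NumberTheory.Automorphic.PicardCM.CMCode (cmTypeMap)

variable {K : Type} [Field K] [NumberField K] [IsCMField K] [IsGalois ℚ K]

/-- **A realisation of a `σ²`-stable CM type of `K` is `𝓞_k`-isogenous to a power of a CM elliptic curve of
`k = K^{⟨σ²⟩}`** (Shimura's type inflation, kernel theorem of the tree modulo `hR`, `h₃`).
[cite: Shimura1998, §6.2 Theorem 3 and §8.2] -/
theorem exists_cmCurve_isogeny_of_sq_stable (hR : DeligneMilne1982_Thm_6_20_full) (h₃ : CMAbelianVarietyRealised)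
    (h6 : Module.finrank ℚ K = 6) (σ : K ≃ₐ[ℚ] K) (hσ : orderOf σ = 6) (h3 : σ ^ 3 = conjGal)
    {Φ : CMType K} (hΦ : cmTypeMap (σ ^ 2).toRingEquiv Φ = Φ)
    {A : AbelianVariety ℂ} {ι : 𝓞 K →+* End A} {θ : K →+* Module.End ℂ (complexBetti A.X 1)}
    (hA : IsCMTypeRealisation Φ A ι θ) :
    ∃ (Φ₀ : CMType (IntermediateField.fixedField (Subgroup.zpowers (σ ^ 2))))
      (E : AbelianVariety ℂ) (ιE : 𝓞 (IntermediateField.fixedField (Subgroup.zpowers (σ ^ 2))) →+* End E)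
      (θE : (IntermediateField.fixedField (Subgroup.zpowers (σ ^ 2))) →+* Module.End ℂ (complexBetti E.X 1)),
      IsCMTypeRealisation Φ₀ E ιE θE ∧ E.dim = 1 ∧
      ∃ (h : ℕ) (P : AbelianVariety ℂ) (π : Fin h → (P ⟶ E)), Nonempty (IsLimit (Fan.mk P π)) ∧
        ∃ g : A ⟶ P, AbelianVariety.IsIsogeny g ∧
          ∀ (j : Fin h) (a : 𝓞 (IntermediateField.fixedField (Subgroup.zpowers (σ ^ 2)))),
            ι (RingOfIntegers.mapRingHom
                (algebraMap (IntermediateField.fixedField (Subgroup.zpowers (σ ^ 2))) K) a) ≫ (g ≫ π j) =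
              (g ≫ π j) ≫ ιE a := by
  haveI := isCMField_fixedField_sq σ hσ h3
  obtain ⟨Φ₀, hΦ₀⟩ := exists_inducedCMType_of_sq_stable σ Φ hΦ
  rw [hΦ₀] at hA
  obtain ⟨E, ιE, θE, hE, h, P, π, hlim, g, hg, hcomm⟩ :=
    thm3_isogenousPower_of_riemann hR h₃ _ K
      (algebraMap (IntermediateField.fixedField (Subgroup.zpowers (σ ^ 2))) K) Φ₀ A ι θ hA
  refine ⟨Φ₀, E, ιE, θE, hE, ?_, h, P, π, hlim, g, hg, hcomm⟩
  rw [show E.dim = _ from Literature.AlgebraicGeometry.Motives.schemeDim_eq_holds hE.1, finrank_fixedField_sq σ h6 hσ]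

/-- **The induced corner of a face is a power of a CM elliptic curve, up to `𝓞_k`-isogeny**: for every
rank-four face `f` of the Galois sextic CM field `K` and realisations `(A_j, ι_j, θ_j)` of its corners there is a
corner `j₀` with `A_{j₀} → E^h` an `𝓞_k`-equivariant isogeny onto a power of a CM elliptic curve `E` of
`k = K^{⟨σ²⟩}`; every other corner is NOT `σ²`-stable (primitive).  Blueprint L3 (`ν_j := g ≫ π_j`), modulo the
displayed `hR`, `h₃`. [cite: Shimura1998, §6.2 Theorem 3 and §8.2] -/
theorem face_induced_corner_isogenous_cmCurve_power (hR : DeligneMilne1982_Thm_6_20_full)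
    (h₃ : CMAbelianVarietyRealised) (h6 : Module.finrank ℚ K = 6) (σ : K ≃ₐ[ℚ] K) (hσ : orderOf σ = 6)
    (h3 : σ ^ 3 = conjGal) (f : Face K)
    (A : Fin 4 → AbelianVariety ℂ) (ι : ∀ j, 𝓞 K →+* End (A j))
    (θ : ∀ j, K →+* Module.End ℂ (complexBetti (A j).X 1))
    (hA : ∀ j, IsCMTypeRealisation (f.corner j) (A j) (ι j) (θ j)) :
    ∃ j₀ : Fin 4, (∀ j, j ≠ j₀ → cmTypeMap (σ ^ 2).toRingEquiv (f.corner j) ≠ f.corner j) ∧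
      ∃ (Φ₀ : CMType (IntermediateField.fixedField (Subgroup.zpowers (σ ^ 2))))
        (E : AbelianVariety ℂ) (ιE : 𝓞 (IntermediateField.fixedField (Subgroup.zpowers (σ ^ 2))) →+* End E)
        (θE : (IntermediateField.fixedField (Subgroup.zpowers (σ ^ 2))) →+* Module.End ℂ (complexBetti E.X 1)),
        IsCMTypeRealisation Φ₀ E ιE θE ∧ E.dim = 1 ∧
        ∃ (h : ℕ) (P : AbelianVariety ℂ) (π : Fin h → (P ⟶ E)), Nonempty (IsLimit (Fan.mk P π)) ∧
          ∃ g : A j₀ ⟶ P, AbelianVariety.IsIsogeny g ∧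
            ∀ (j : Fin h) (a : 𝓞 (IntermediateField.fixedField (Subgroup.zpowers (σ ^ 2)))),
              ι j₀ (RingOfIntegers.mapRingHom
                  (algebraMap (IntermediateField.fixedField (Subgroup.zpowers (σ ^ 2))) K) a) ≫ (g ≫ π j) =
                (g ≫ π j) ≫ ιE a := by
  obtain ⟨j₀, j₁, j₂, j₃, -, h0, hprim, -, -⟩ := face_corner_pattern σ h6 hσ h3 f
  exact ⟨j₀, hprim, exists_cmCurve_isogeny_of_sq_stable hR h₃ h6 σ hσ h3 h0 (hA j₀)⟩

end Summit.HodgeConjecture.CorCM.CyclicSextic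

end
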